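import Mathlib
import Literature.Probability.LatticeModels.ProdBernoulliIndependence
import Summits.CriticalPhenomena.PercolationContinuityZ3.Theorems.PercNearOneGluingNearOneGluingTransferIneq
import Summits.CriticalPhenomena.PercolationContinuityZ3.Theorems.PercNearOneGluingNearOneGluingExposureDecomp
import Summits.CriticalPhenomena.PercolationContinuityZ3.Theorems.PercNearOneGluingNearOneGluingLayerCake
import Summits.CriticalPhenomena.PercolationContinuityZ3.Theorems.PercNearOneGluingNearOneGluingSprinkleCoupling
import HarnessLib

/-!
# Crux `PercNearOneGluing.NearOneGluing` (stmt-CriticalPhenomena-4574), line `live-seal-vanishing-sprinkle` —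
# deliverables K1 (exposure bound) and K1′ (Kozma–Nitzan Conjecture 3 after a vanishing sprinkle)

Lead prover-line-stmt-CriticalPhenomena-4574-a1-0, 2026-08-16.  Lands with `--supports stmt-CriticalPhenomena-4574`:
these are the line's theorem-grade outputs, composed from the four landed stubs
`stub_transferIneq`, `stub_exposureDecomp`, `stub_layerCake`, `stub_sprinkleCoupling`.

Setting: one finite weighted graph — vertices `Fin n`, weights `w`, `μ_w = prodBernoulli w` on bond
configurations `ω : Set (Sym2 (Fin n))`; relay set `A`, source `o ∉ A`, target `b`;
bad `= {o ↮ b} ∩ {o ↔ A}`; `P ω` the relay-free pocket of `o` (any selector with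
`v ∈ P ω ↔ o ↔ v inside (↑A)ᶜ`); `L T ω` the live boundary pairs of `T` towards `b`
(`s(x,y)`, `x ∈ T`, `y ∉ T`, `y ↔ b inside (↑T)ᶜ`); `κ(ω) = ∏_{e ∈ L (P ω) ω} (1 - w e)`.

* `liveSeal_exposureBound` (**K1**, `|A|`-free): `max_a μ(a ↮ b) ≤ s` ⇒ `μ(bad ∧ θ ≤ κ) ≤ s/θ` for every
  `θ > 0` — buffered bad configurations (cheap live seal) are paid for by ONE attached relay.
* `sprinkledNearOneGluing` (**K1′**, `|A|`-free): for `0 < t < 1` and `1 - w' = (1 - w)^{1+t}`: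
  `μ_{w'}(o ↮ b) ≤ μ_w(o ↮ A) + (max_a μ_w(a ↮ b))^t/(1-t)`.  With `s = δ`, `t = log(2/ε)/log(1/δ)` the
  loss is `≤ ε`: Conjecture 3 HOLDS after multiplying every pair's log-failure rate `log(1/(1-w_e))` by
  `1 + log(2/ε)/log(1/δ)` — a sprinkle that vanishes as `δ → 0`.  (Barrier honesty: this is a sprinkled
  statement, `Literature.Barriers.CriticalPhenomena.SprinklingRenormalisation` bites it; the `t = 0`
  endpoint is the crux.)
* `unboostedNearOneGluing` (K1′ read backwards): `μ_w(o ↮ b) ≤ μ_v(o ↮ A) + t_v^{s/(1-s)}/(1 - s/(1-s))` for the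
  un-boosted weights `1 - v = (1 - w)^{1-s}`, `0 < s < 1/2` — every instance whose hypotheses survive the un-boost
  satisfies the crux; counterexamples are critical.
-/

namespace Summit.CriticalPhenomena.PercolationContinuityZ3.Theorems

open scoped BigOperators Classical
open MeasureTheory Set
open Literature.Probability.LatticeModels (prodBernoulli)
open Literature.Probability.Percolation (openConn openConnIn)

/-- **K1 (exposure bound), `|A|`-free.** If `o ∉ A` and `μ(a ↮ b) ≤ s` for every `a ∈ A` then for
every `θ > 0`: `μ{o ↮ b ∧ o ↔ A ∧ θ ≤ κ_{S₀}} ≤ s/θ`, for any pocket/live selectors `P`, `L`.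
Composition of the landed `stub_exposureDecomp` (strong Markov at the pocket + Markov in `θ`) with
`stub_transferIneq` (one attached relay pays). [this tree, line live-seal-vanishing-sprinkle] -/
theorem liveSeal_exposureBound : ∀ (n : ℕ) (w : Sym2 (Fin n) → unitInterval) (A : Finset (Fin n)) (o b : Fin n), o ∉ A → ∀ (s θ : ℝ), 0 ≤ s → 0 < θ → (∀ a ∈ A, (Literature.Probability.LatticeModels.prodBernoulli w).real (Literature.Probability.Percolation.openConn a b)ᶜ ≤ s) → ∀ (P : Set (Sym2 (Fin n)) → Finset (Fin n)), (∀ ω v, v ∈ P ω ↔ ω ∈ Literature.Probability.Percolation.openConnIn ((↑A : Set (Fin n))ᶜ) o v) → ∀ (L : Finset (Fin n) → Set (Sym2 (Fin n)) → Finset (Sym2 (Fin n))), (∀ T ω e, e ∈ L T ω ↔ ∃ x ∈ T, ∃ y ∉ T, e = s(x, y) ∧ ω ∈ Literature.Probability.Percolation.openConnIn ((↑T : Set (Fin n))ᶜ) y b) → (Literature.Probability.LatticeModels.prodBernoulli w).real {ω | ω ∉ Literature.Probability.Percolation.openConn o b ∧ (∃ a ∈ A, ω ∈ Literature.Probability.Percolation.openConn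 o a) ∧ θ ≤ ∏ e ∈ L (P ω) ω, (1 - (w e : ℝ))} ≤ s / θ := by
  intro n w A o b ho s θ hs hθ hrel P hP L hL
  refine stub_exposureDecomp n w A o b ho s θ hs hθ P hP L hL ?_
  intro T E a ha hEA _hoT hbT _hTA
  exact (stub_transferIneq n w T E a b ha hbT (L T) (hL T)).trans (hrel a (hEA ha))

/-- **K1′ (sprinkled near-one gluing), the line's deliverable, `|A|`-free.** For `0 < t < 1` and
weights with `1 - w' = (1 - w)^{1+t}`: if `o ∉ A` and `μ_w(a ↮ b) ≤ s` on `A` (`0 ≤ s`) then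
`μ_{w'}(o ↮ b) ≤ μ_w(o ↮ A) + s^t/(1-t)`.  Proof: `stub_sprinkleCoupling` (union of an independent
`t`-layer; a layer pair on the live seal joins `o` to `b`) bounds the left side by
`μ_w(o ↮ A) + ∫_bad κ^t`, and `stub_layerCake` turns K1's tail bounds into `∫_bad κ^t ≤ s^t/(1-t)`.
[this tree, line live-seal-vanishing-sprinkle] -/
theorem sprinkledNearOneGluing : ∀ (t : ℝ), 0 < t → t < 1 → ∀ (n : ℕ) (w w' : Sym2 (Fin n) → unitInterval), (∀ e, (1 - (w' e : ℝ)) = (1 - (w e : ℝ)) ^ (1 + t)) → ∀ (A : Finset (Fin n)) (o b : Fin n), o ∉ A → ∀ (s : ℝ), 0 ≤ s → (∀ a ∈ A, (Literature.Probability.LatticeModels.prodBernoulli w).real (Literature.Probability.Percolation.openConn a b)ᶜ ≤ s) → (Literature.Probability.LatticeModels.prodBernoulli w').real (Literature.Probability.Percolation.openConn o b)ᶜ ≤ (Literature.Probability.LatticeModels.prodBernoulli w).real (⋃ a ∈ A, Literature.Probability.Percolation.openConn o a)ᶜ + s ^ t / (1 - t) := by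
  intro t ht0 ht1 n w w' hw A o b ho s hs hrel
  -- concrete selectors
  set P : Set (Sym2 (Fin n)) → Finset (Fin n) :=
    fun ω => Finset.univ.filter fun v => ω ∈ openConnIn ((↑A : Set (Fin n))ᶜ) o v with hPdef
  set L : Finset (Fin n) → Set (Sym2 (Fin n)) → Finset (Sym2 (Fin n)) :=
    fun T ω => Finset.univ.filter fun e : Sym2 (Fin n) =>
      ∃ x ∈ T, ∃ y ∉ T, e = s(x, y) ∧ ω ∈ openConnIn ((↑T : Set (Fin n))ᶜ) y b with hLdef
  have hP : ∀ ω v, v ∈ P ω ↔ ω ∈ openConnIn ((↑A : Set (Fin n))ᶜ) o v := by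
    intro ω v; simp [hPdef]
  have hL : ∀ T ω e, e ∈ L T ω ↔
      ∃ x ∈ T, ∃ y ∉ T, e = s(x, y) ∧ ω ∈ openConnIn ((↑T : Set (Fin n))ᶜ) y b := by
    intro T ω e; simp [hLdef]
  have hcpl := stub_sprinkleCoupling t ht0 n w w' hw A o b ho P hP L hL
  -- layer cake on X = κ, B = bad
  set B : Set (Set (Sym2 (Fin n))) := {ω | ω ∉ openConn o b ∧ ∃ a ∈ A, ω ∈ openConn o a} with hBdef
  set X : Set (Sym2 (Fin n)) → ℝ := fun ω => ∏ e ∈ L (P ω) ω, (1 - (w e : ℝ)) with hXdef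
  have hX0 : ∀ ω, 0 ≤ X ω := fun ω =>
    Finset.prod_nonneg fun e _ => sub_nonneg.2 (w e).2.2
  have hX1 : ∀ ω, X ω ≤ 1 := fun ω =>
    Finset.prod_le_one (fun e _ => sub_nonneg.2 (w e).2.2) fun e _ => sub_le_self _ (w e).2.1
  have htail : ∀ θ : ℝ, 0 < θ →
      (prodBernoulli w).real (B ∩ {ω | θ ≤ X ω}) ≤ s / θ := by
    intro θ hθ
    have h := liveSeal_exposureBound n w A o b ho s θ hs hθ hrel P hP L hL
    have hset : B ∩ {ω | θ ≤ X ω} =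
        {ω | ω ∉ openConn o b ∧ (∃ a ∈ A, ω ∈ openConn o a) ∧ θ ≤ ∏ e ∈ L (P ω) ω, (1 - (w e : ℝ))} := by
      ext ω; simp only [hBdef, hXdef, mem_inter_iff, mem_setOf_eq, and_assoc]
    rw [hset]; exact h
  have hlc := stub_layerCake (prodBernoulli w) B MeasurableSet.of_discrete X
    (Measurable.of_discrete) hX0 hX1 s t hs ht0 ht1 htail
  have hint : ∫ ω, (B.indicator (fun ω => (∏ e ∈ L (P ω) ω, (1 - (w e : ℝ))) ^ t) ω)
      ∂(prodBernoulli w) ≤ s ^ t / (1 - t) := by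
    simpa [hXdef] using hlc
  calc (prodBernoulli w').real (openConn o b)ᶜ
      ≤ (prodBernoulli w).real (⋃ a ∈ A, openConn o a)ᶜ +
          ∫ ω, (B.indicator (fun ω => (∏ e ∈ L (P ω) ω, (1 - (w e : ℝ))) ^ t) ω)
            ∂(prodBernoulli w) := by simpa [hBdef] using hcpl
    _ ≤ (prodBernoulli w).real (⋃ a ∈ A, openConn o a)ᶜ + s ^ t / (1 - t) := by gcongr

/-- **K1′ read backwards (robustness / un-boost form; uses the `o`-hypothesis of the UN-BOOSTED instance).**
For `0 < s < 1/2` and un-boosted weights `v ≤ w` with `1 - v = (1 - w)^{1-s}`: if `o ∉ A` and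
`μ_v(a ↮ b) ≤ t_v` on `A` then `μ_w(o ↮ b) ≤ μ_v(o ↮ A) + t_v^{s/(1-s)}/(1 - s/(1-s))`
(`1/(1 - s/(1-s)) = (1-s)/(1-2s)`).  So every instance whose HYPOTHESES survive un-boosting the
log-failure rates by the factor `1 - s` satisfies the crux at the original weights; with `s ≈ 2 log(4/ε)/log(1/δ)`
each closed-cylinder probability `≥ δ^k` moves by a factor `≤ (4/ε)^{2k}` only, hence a counterexample must be
CRITICAL: `o`'s access to `A`, or the reliability of the accessible relays, collapses under a `1/log(1/δ)`
un-boost.  Proof: `sprinkledNearOneGluing` with base weights `v` and boost `t = s/(1-s)`, since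
`((1-w)^{1-s})^{1/(1-s)} = 1 - w`. [this tree, line live-seal-vanishing-sprinkle] -/
theorem unboostedNearOneGluing : ∀ (s : ℝ), 0 < s → s < 1 / 2 → ∀ (n : ℕ) (w v : Sym2 (Fin n) → unitInterval), (∀ e, (1 - (v e : ℝ)) = (1 - (w e : ℝ)) ^ (1 - s)) → ∀ (A : Finset (Fin n)) (o b : Fin n), o ∉ A → ∀ (tv : ℝ), 0 ≤ tv → (∀ a ∈ A, (Literature.Probability.LatticeModels.prodBernoulli v).real (Literature.Probability.Percolation.openConn a b)ᶜ ≤ tv) → (Literature.Probability.LatticeModels.prodBernoulli w).real (Literature.Probability.Percolation.openConn o b)ᶜ ≤ (Literature.Probability.LatticeModels.prodBernoulli v).real (⋃ a ∈ A, Literature.Probability.Percolation.openConn o a)ᶜ + tv ^ (s / (1 - s)) / (1 - s / (1 - s)) := by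
  intro s hs0 hs1 n w v hv A o b ho tv htv hrel
  have h1s : 0 < 1 - s := by linarith
  have ht0 : 0 < s / (1 - s) := div_pos hs0 h1s
  have ht1 : s / (1 - s) < 1 := by rw [div_lt_one h1s]; linarith
  refine sprinkledNearOneGluing (s / (1 - s)) ht0 ht1 n v w ?_ A o b ho tv htv hrel
  intro e
  have hw0 : 0 ≤ 1 - (w e : ℝ) := sub_nonneg.2 (w e).2.2
  have hexp : (1 - s) * (1 + s / (1 - s)) = 1 := by
    field_simp
    ring
  calc (1 - (w e : ℝ)) = (1 - (w e : ℝ)) ^ ((1 - s) * (1 + s / (1 - s))) := by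
        rw [hexp, Real.rpow_one]
    _ = ((1 - (w e : ℝ)) ^ (1 - s)) ^ (1 + s / (1 - s)) := Real.rpow_mul hw0 _ _
    _ = (1 - (v e : ℝ)) ^ (1 + s / (1 - s)) := by rw [hv e]

end Summit.CriticalPhenomena.PercolationContinuityZ3.Theorems
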